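import Literature.AlgebraicGeometry.HodgeTheory.WeilTypeProducts
import Literature.AlgebraicGeometry.Motives.HodgeLieDiagonal
import Summits.HodgeConjecture.CorCM.MumfordTateRankTimesCMCurve
import Summits.HodgeConjecture.CorCM.MumfordTateRankOfPowers
import HarnessLib

/-!
# Powers `B^{m+1}` with the diagonal endomorphism `ψ^{m+1}`: square, multiplicities, and `(ψ^{m+1})^* ∈ Lie Hg(H¹(B^{m+1}))`;
# the CM elliptic curve case `χ^* ∈ Lie Hg(H¹E)`, `dim Lie Hg(H¹(E^{m+1})) = 1`
# (bookkeeping for Moonen–Zarhin-type Weil-class arguments on `A × E^{g−2}`)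

COR-CM (cell `pub-hodgecm2`, seat `b27` gen 48, count-neutral Mumford–Tate-rank ladder; theorems only, no definition, no named fact;
UNCONDITIONAL — nothing here uses or asserts HC_CM).  For an endomorphism `ψ` of an abelian variety `B` and the componentwise
endomorphism `ψ^{m+1} = powSuccMap ψ m` of `B^{m+1} = B.powSucc m`:
* §1 `powSuccMap_comp_self_eq_neg` (`ψ ∘ ψ = −d ⟹ ψ^{m+1} ∘ ψ^{m+1} = −d`), `eigenMultiplicity_powSuccMap`
  (`n_μ(B^{m+1}, ψ^{m+1}) = (m+1) · n_μ(B, ψ)`, Künneth in degree one), `diag_comp_powSuccMap` (the diagonal `B → B^{m+1}` is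
  `ψ`-equivariant).
* §2 **`pull_powSuccMap_mem_hodgeLie`** — if `ψ^* ∈ Lie Hg(H¹B)` then `(ψ^{m+1})^* ∈ Lie Hg(H¹(B^{m+1}))` for every `m`: induction on `m`,
  Moonen's block transfer `mem_hodgeLie_of_blocks` along the two block pairs `H¹(B^{m+1}) ⇄ H¹(B^{m+1} × B)` given by
  (`fst`, `(𝟙, 0)`) and (`snd ≫ diag`, `pr₀ ≫ (0, 𝟙)`), which sum to the identity and intertwine `(ψ^{m+1})^*` with `(ψ^{m+2})^*`.
* §3 the CM elliptic curve: **`bettiMap_mem_hodgeLie_of_cmCurve`** (`χ ∘ χ = −D` on an elliptic curve ⟹ `χ^* ∈ Lie Hg(H¹E) = ℚχ^*`),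
  **`finrank_hodgeLie_hodge_one_powSucc_eq`** (`dim Lie Hg(H¹(B^{m+1})) = dim Lie Hg(H¹B)`, from `CorCM/MumfordTateRankOfPowers`).
Used by `CorCM/MumfordTateRankRibetTimesCMCurveSameField` (`t(A × E) = g² + 1` for Ribet type `(g−1,1)` and a same-field CM curve).

## References
* [MoonenZarhin1999LowDim] B. Moonen, Yu. G. Zarhin, Math. Ann. 315 (1999), §1, (1.9), §3 (3.1) [corpus: paper:arxiv-math_9901113 pp. 2–3, 6].
  [cite: MoonenZarhin1999LowDim, §1 and §3]
* [Moonen1999MTNotes] B. Moonen, *Notes on Mumford–Tate groups* (1999), (1.8), (1.13). [cite: Moonen1999MTNotes, (1.8) and (1.13)]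
* [LangeBirkenhake1992] H. Lange, Ch. Birkenhake, *Complex Abelian Varieties* (1992), §1.1 (analytic representation, Künneth in degree one).
  [cite: LangeBirkenhake1992, §1.1 (p. 19)]
* [MumfordAV1970] D. Mumford, *Abelian Varieties* (1970), §19. [cite: MumfordAV1970, §19 Thm. 3 and Cor. 2]
-/

noncomputable section

open CategoryTheory CategoryTheory.Limits Module

namespace Summit.HodgeConjecture.CorCM

open Literature.AlgebraicGeometry.Motives
open Literature.AlgebraicGeometry.Motives.AbelianVariety
open Literature.AlgebraicGeometry.Motives.HodgeStructure
open Literature.AlgebraicGeometry.HodgeTheory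
open Literature.AlgebraicGeometry.ComplexMultiplication
open Literature.AlgebraicGeometry.Milne1999 (powProj powLift powFst powSnd powPair pow_hom_ext powLift_powProj powPair_powFst powPair_powSnd
  IsOfCMType)
open Literature.AlgebraicGeometry.Pohlmann1968 (isIsogenous_powSucc_biproduct)

/-! ## §1 The componentwise endomorphism `ψ^{m+1}` of `B^{m+1}` -/

section Powers

variable {B : AbelianVariety ℂ}

/-- `ψ ∘ ψ = −d ⟹ ψ^{m+1} ∘ ψ^{m+1} = −d` on `B^{m+1}` (`ψ^{m+2} = (ψ^{m+1}, ψ)` on `B^{m+1} × B`, `prodLift_comp_self_eq_neg`).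
[cite: MumfordAV1970, §19 Thm. 3 and Cor. 2] [cite: MoonenZarhin1999LowDim, (1.9)] -/
theorem powSuccMap_comp_self_eq_neg (ψ : B ⟶ B) {d : ℕ} (hψ : ψ ≫ ψ = -(d • 𝟙 B)) :
    ∀ m : ℕ, powSuccMap ψ m ≫ powSuccMap ψ m = -(d • 𝟙 (B.powSucc m))
  | 0 => by rw [powSuccMap_zero_eq]; exact hψ
  | m + 1 => by
    rw [powSuccMap_succ_eq_powPair]
    exact prodLift_comp_self_eq_neg (powSuccMap_comp_self_eq_neg ψ hψ m) hψ

/-- Additivity of the `H^{1,0}`-multiplicity over `A × B` with the product endomorphism (Künneth in degree one; cf. ring2's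
`Ring2.Atlas.eigenMultiplicity_prodLift`). [cite: LangeBirkenhake1992, §1.1 (p. 19)] -/
private theorem eigenMultiplicity_prodLift' {A : AbelianVariety ℂ} (φ : A ⟶ A) (ψ : B ⟶ B) (μ : ℂ) :
    eigenMultiplicity (A.prod B) (prodLift (fst A B ≫ φ) (snd A B ≫ ψ)) μ = eigenMultiplicity A φ μ + eigenMultiplicity B ψ μ := by
  have h := finrank_eigenspace_inf_hodgeOneZero_prod (A := A) (B := B) rfl rfl φ ψ μ
  unfold eigenMultiplicity
  rw [← Literature.AlgebraicGeometry.Deligne1982.hodgeOneZero_eq_of_dim_eq (A := A.prod B) (dim_prod A B) (isSmoothProjective_of_dim_eq' (dim_prod A B))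
    (AbelianVariety.isSmoothProjective_holds (A := A.prod B))]
  exact h

/-- **`n_μ(B^{m+1}, ψ^{m+1}) = (m+1) · n_μ(B, ψ)`**: the multiplicity of an eigenvalue on `H^{1,0}` of the power with the componentwise
endomorphism. [cite: LangeBirkenhake1992, §1.1 (p. 19)] [cite: MoonenZarhin1999LowDim, (1.9)] -/
theorem eigenMultiplicity_powSuccMap (ψ : B ⟶ B) (μ : ℂ) :
    ∀ m : ℕ, eigenMultiplicity (B.powSucc m) (powSuccMap ψ m) μ = (m + 1) * eigenMultiplicity B ψ μ
  | 0 => by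
    rw [powSuccMap_zero_eq, zero_add, one_mul]
    rfl
  | m + 1 => by
    rw [powSuccMap_succ_eq_powPair]
    change eigenMultiplicity ((B.powSucc m).prod B) (prodLift (fst (B.powSucc m) B ≫ powSuccMap ψ m) (snd (B.powSucc m) B ≫ ψ)) μ = _
    rw [eigenMultiplicity_prodLift', eigenMultiplicity_powSuccMap ψ μ m]
    ring

/-- The diagonal `Δ = (𝟙, …, 𝟙) : B → B^{m+1}` followed by a projection is the identity. [cite: MumfordAV1970, §19 Thm. 3 and Cor. 2] -/
theorem diag_comp_powProj (m : ℕ) (r : Fin (m + 1)) : powLift m (fun _ => 𝟙 B) ≫ powProj B m r = 𝟙 B :=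
  powLift_powProj m _ r

/-- The diagonal is `ψ`-equivariant: `Δ ∘ ψ = ψ^{m+1} ∘ Δ`. [cite: MumfordAV1970, §19 Thm. 3 and Cor. 2] -/
theorem diag_comp_powSuccMap (ψ : B ⟶ B) (m : ℕ) : powLift m (fun _ => 𝟙 B) ≫ powSuccMap ψ m = ψ ≫ powLift m (fun _ => 𝟙 B) :=
  pow_hom_ext m fun r => by
    rw [Category.assoc, powSuccMap_powProj, ← Category.assoc, diag_comp_powProj, Category.id_comp, Category.assoc, diag_comp_powProj,
      Category.comp_id]

/-- Pull-back along a composite: `(f ≫ g)^* = f^* ∘ g^*` on `H¹`. [folklore] -/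
private theorem pull_comp' {A₁ A₂ A₃ : AbelianVariety ℂ} (f : A₁ ⟶ A₂) (g : A₂ ⟶ A₃) :
    BettiUniverse.pull (f ≫ g).hom.hom.hom 1 = BettiUniverse.pull f.hom.hom.hom 1 ∘ₗ BettiUniverse.pull g.hom.hom.hom 1 := by
  have h := bettiCohomology_map_comp_hom f g 1
  change (bettiCohomology.map (f ≫ g).hom.hom.hom 1).hom = _
  rw [h, ModuleCat.hom_comp]

end Powers

/-! ## §2 `(ψ^{m+1})^* ∈ Lie Hg(H¹(B^{m+1}))` from `ψ^* ∈ Lie Hg(H¹B)` -/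

section Membership

variable [HodgeTensorFacts.{0, 0}] {B C : AbelianVariety ℂ}

/-- **Adding an equivariant retract factor keeps the diagonal operator in `Lie Hg`.**  Let `δ ∈ End C`, `ψ ∈ End B`, and let `B` be a
`(ψ, δ)`-equivariant retract of `C` (`Δ : B → C`, `p₀ : C → B`, `Δ ≫ p₀ = 𝟙`, `Δ ≫ δ = ψ ≫ Δ`, `δ ≫ p₀ = p₀ ≫ ψ`).  If `δ^* ∈ Lie Hg(H¹C)` then
`(δ × ψ)^* ∈ Lie Hg(H¹(C × B))`: Moonen's block transfer `mem_hodgeLie_of_blocks` along the two block pairs `H¹C ⇄ H¹(C × B)` pulled back from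
(`fst`, `(𝟙,0)`) and (`snd ≫ Δ`, `p₀ ≫ (0,𝟙)`), which sum to the identity and intertwine `δ^*` with `(δ × ψ)^*`.
[cite: Moonen1999MTNotes, (1.8) and (1.13)] [cite: MoonenZarhin1999LowDim, §1 and §3] -/
theorem pull_prodLift_mem_hodgeLie_of_retract (δ : C ⟶ C) (ψ : B ⟶ B) (Δ : B ⟶ C) (p₀ : C ⟶ B) (hΔp : Δ ≫ p₀ = 𝟙 B)
    (hΔ : Δ ≫ δ = ψ ≫ Δ) (hp₀ : δ ≫ p₀ = p₀ ≫ ψ) {k k' : ℕ} (hC : IsSmoothProjective k C.X) (hP : IsSmoothProjective k' (C.prod B).X)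
    (hδ : haveI := BettiUniverse.finite hC 1
      BettiUniverse.pull δ.hom.hom.hom 1 ∈ (BettiUniverse.hodge exists_isReal_hodgeModel_holds hC 1).hodgeLie) :
    haveI := BettiUniverse.finite hP 1
    BettiUniverse.pull (prodLift (fst C B ≫ δ) (snd C B ≫ ψ)).hom.hom.hom 1 ∈
      (BettiUniverse.hodge exists_isReal_hodgeModel_holds hP 1).hodgeLie := by
  classical
  haveI := BettiUniverse.finite hC 1
  haveI := BettiUniverse.finite hP 1
  set δ' := prodLift (fst C B ≫ δ) (snd C B ≫ ψ) with hδ'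
  -- the maps of the two block pairs
  let i₁ : C ⟶ C.prod B := prodLift (𝟙 C) (0 : C ⟶ B)
  let i₂ : B ⟶ C.prod B := prodLift (0 : B ⟶ C) (𝟙 B)
  -- category identities
  have hsumC : fst C B ≫ i₁ + (snd C B ≫ Δ) ≫ (p₀ ≫ i₂) = 𝟙 (C.prod B) := by
    rw [Category.assoc, ← Category.assoc Δ, hΔp, Category.id_comp]
    refine prod_hom_ext ?_ ?_
    · rw [Preadditive.add_comp, Category.assoc, Category.assoc, prodLift_fst, prodLift_fst, Category.comp_id, comp_zero, add_zero,
        Category.id_comp]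
    · rw [Preadditive.add_comp, Category.assoc, Category.assoc, prodLift_snd, prodLift_snd, Category.comp_id, comp_zero, zero_add,
        Category.id_comp]
  have h1 : fst C B ≫ δ = δ' ≫ fst C B := by rw [hδ', prodLift_fst]
  have h2 : (snd C B ≫ Δ) ≫ δ = δ' ≫ (snd C B ≫ Δ) := by
    rw [Category.assoc, hΔ, ← Category.assoc, hδ', ← Category.assoc, prodLift_snd]
  have h3 : i₁ ≫ δ' = δ ≫ i₁ := by
    refine prod_hom_ext ?_ ?_
    · simp only [hδ', i₁, Category.assoc, prodLift_fst, prodLift_fst_assoc, Category.comp_id, Category.id_comp]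
    · simp only [hδ', i₁, Category.assoc, prodLift_snd, prodLift_snd_assoc, comp_zero, zero_comp]
  have h4 : (p₀ ≫ i₂) ≫ δ' = δ ≫ (p₀ ≫ i₂) := by
    refine prod_hom_ext ?_ ?_
    · simp only [hδ', i₂, Category.assoc, prodLift_fst, prodLift_fst_assoc, comp_zero, zero_comp]
    · simp only [hδ', i₂, Category.assoc, prodLift_snd, prodLift_snd_assoc, Category.comp_id, Category.id_comp, hp₀]
  -- the block pairs as morphisms of Hodge structures
  let inj : Fin 2 → Hom (BettiUniverse.hodge exists_isReal_hodgeModel_holds hC 1) (BettiUniverse.hodge exists_isReal_hodgeModel_holds hP 1) :=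
    ![BettiUniverse.pullHodgeHom exists_isReal_hodgeModel_holds hodgePQ_independent_of_hodgeModel_holds hP hC (fst C B).hom.hom.hom 1,
      BettiUniverse.pullHodgeHom exists_isReal_hodgeModel_holds hodgePQ_independent_of_hodgeModel_holds hP hC (snd C B ≫ Δ).hom.hom.hom 1]
  let pr : Fin 2 → Hom (BettiUniverse.hodge exists_isReal_hodgeModel_holds hP 1) (BettiUniverse.hodge exists_isReal_hodgeModel_holds hC 1) :=
    ![BettiUniverse.pullHodgeHom exists_isReal_hodgeModel_holds hodgePQ_independent_of_hodgeModel_holds hC hP i₁.hom.hom.hom 1,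
      BettiUniverse.pullHodgeHom exists_isReal_hodgeModel_holds hodgePQ_independent_of_hodgeModel_holds hC hP (p₀ ≫ i₂).hom.hom.hom 1]
  have hblocks : ∑ j, (inj j).toLinearMap ∘ₗ (pr j).toLinearMap = LinearMap.id := by
    rw [Fin.sum_univ_two]
    refine LinearMap.ext fun v => ?_
    exact pull_pull_add_pull_pull_eq_self _ _ _ _ hsumC v
  refine mem_hodgeLie_of_blocks inj pr hblocks hδ ?_ ?_
  · intro j
    fin_cases j
    · change BettiUniverse.pull (fst C B).hom.hom.hom 1 ∘ₗ BettiUniverse.pull δ.hom.hom.hom 1 =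
        BettiUniverse.pull δ'.hom.hom.hom 1 ∘ₗ BettiUniverse.pull (fst C B).hom.hom.hom 1
      rw [← pull_comp', ← pull_comp', h1]
    · change BettiUniverse.pull (snd C B ≫ Δ).hom.hom.hom 1 ∘ₗ BettiUniverse.pull δ.hom.hom.hom 1 =
        BettiUniverse.pull δ'.hom.hom.hom 1 ∘ₗ BettiUniverse.pull (snd C B ≫ Δ).hom.hom.hom 1
      rw [← pull_comp', ← pull_comp', h2]
  · intro j
    fin_cases j
    · change BettiUniverse.pull i₁.hom.hom.hom 1 ∘ₗ BettiUniverse.pull δ'.hom.hom.hom 1 =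
        BettiUniverse.pull δ.hom.hom.hom 1 ∘ₗ BettiUniverse.pull i₁.hom.hom.hom 1
      rw [← pull_comp', ← pull_comp', h3]
    · change BettiUniverse.pull (p₀ ≫ i₂).hom.hom.hom 1 ∘ₗ BettiUniverse.pull δ'.hom.hom.hom 1 =
        BettiUniverse.pull δ.hom.hom.hom 1 ∘ₗ BettiUniverse.pull (p₀ ≫ i₂).hom.hom.hom 1
      rw [← pull_comp', ← pull_comp', h4]

/-- **`ψ^* ∈ Lie Hg(H¹B) ⟹ (ψ^{m+1})^* ∈ Lie Hg(H¹(B^{m+1}))`** (the diagonal of `Lie Hg(H¹B)` inside `Lie Hg` of the power; Moonen (1.8) /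
Moonen–Zarhin §1 «`Hg(Xⁿ) = Hg(X)` acting diagonally»).  Induction on `m`: `B^{m+2} = B^{m+1} × B`, `ψ^{m+2} = (ψ^{m+1}, ψ)`, and `B` is an
equivariant retract of `B^{m+1}` through the diagonal `Δ = (𝟙, …, 𝟙)` and the projection `pr₀` (`pull_prodLift_mem_hodgeLie_of_retract`).
[cite: Moonen1999MTNotes, (1.8) and (1.13)] [cite: MoonenZarhin1999LowDim, §1 and §3] -/
theorem pull_powSuccMap_mem_hodgeLie (ψ : B ⟶ B)
    (hψ : haveI := BettiUniverse.finite (AbelianVariety.isSmoothProjective_holds (A := B)) 1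
      BettiUniverse.pull ψ.hom.hom.hom 1 ∈
        (BettiUniverse.hodge exists_isReal_hodgeModel_holds (AbelianVariety.isSmoothProjective_holds (A := B)) 1).hodgeLie) :
    ∀ m : ℕ, haveI := BettiUniverse.finite (AbelianVariety.isSmoothProjective_holds (A := B.powSucc m)) 1
      BettiUniverse.pull (powSuccMap ψ m).hom.hom.hom 1 ∈
        (BettiUniverse.hodge exists_isReal_hodgeModel_holds (AbelianVariety.isSmoothProjective_holds (A := B.powSucc m)) 1).hodgeLie
  | 0 => by rw [powSuccMap_zero_eq]; exact hψ
  | m + 1 => by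
    have ih := pull_powSuccMap_mem_hodgeLie ψ hψ m
    rw [powSuccMap_succ_eq_powPair]
    exact pull_prodLift_mem_hodgeLie_of_retract (powSuccMap ψ m) ψ (powLift m fun _ => 𝟙 B) (powProj B m 0) (diag_comp_powProj m 0)
      (diag_comp_powSuccMap ψ m) (powSuccMap_powProj ψ m 0) AbelianVariety.isSmoothProjective_holds
      (AbelianVariety.isSmoothProjective_holds (A := B.powSucc (m + 1))) ih

end Membership

/-! ## §3 The CM elliptic curve: `χ^* ∈ Lie Hg(H¹E)`, and `dim Lie Hg(H¹(B^{m+1})) = dim Lie Hg(H¹B)` -/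

section CMCurve

variable [HodgeTensorFacts.{0, 0}] {E B X : AbelianVariety ℂ} {n : ℕ}

/-- **`χ^* ∈ Lie Hg(H¹E)` for an elliptic curve with `χ ∘ χ = −D`, `D > 0`** (`E` has complex multiplication, `Lie Hg(H¹E)` is a line inside
`ℚχ^*` — `RankTwoCM.exists_eq_ratCast_smul_of_commute_of_skew` — and non-zero since `t(E) = 2`). [cite: MoonenZarhin1999LowDim, §2 (2.2)]
[cite: Deligne1982HodgeCycles, I §3.1 and Prop. 3.4] -/
theorem bettiMap_mem_hodgeLie_of_cmCurve (hE : IsSmoothProjective n E.X) (hE1 : E.dim = 1) (χ : E ⟶ E) {D : ℕ} (hD : 0 < D)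
    (hχ : χ ≫ χ = -(D • 𝟙 E)) :
    haveI := BettiUniverse.finite hE 1
    (bettiCohomology.map χ.hom.hom.hom 1).hom ∈ (BettiUniverse.hodge exists_isReal_hodgeModel_holds hE 1).hodgeLie := by
  classical
  have hnE : E.dim = n := schemeDim_eq_holds hE
  subst hnE
  haveI := BettiUniverse.finite hE 1
  obtain ⟨hEcm, h2E⟩ := isOfCMType_and_mtRank_eq_two_of_curve_of_comp_self_eq_neg hE hE1 χ hD hχ
  have hE2 : Module.finrank ℚ E.endAlgebra = 2 := finrank_endAlgebra_eq_two_of_cmCurve hE1 hEcm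
  have hV₂ : Module.finrank ℚ (bettiCohomology E.X 1) = 2 := by rw [finrank_bettiCohomology_one, hE1]
  have h1 : Module.finrank ℚ (BettiUniverse.hodge exists_isReal_hodgeModel_holds hE 1).hodgeLie = 1 := by
    have h := mtRank_hodge_one_eq_finrank_hodgeLie_add_one hE (by omega)
    omega
  obtain ⟨Y, hY, hY0⟩ : ∃ Y ∈ (BettiUniverse.hodge exists_isReal_hodgeModel_holds hE 1).hodgeLie, Y ≠ 0 := by
    by_contra h
    push Not at h
    have hbot : (BettiUniverse.hodge exists_isReal_hodgeModel_holds hE 1).hodgeLie = ⊥ := (Submodule.eq_bot_iff _).2 h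
    rw [hbot, finrank_bot] at h1
    exact absurd h1 (by norm_num)
  obtain ⟨ψE⟩ := BettiUniverse.hodge_isPolarizable exists_isReal_hodgeModel_holds hE 1
  obtain ⟨hχE, hχ2, -⟩ := quadraticEnd_skewCentre_data exists_isReal_hodgeModel_holds hodgePQ_independent_of_hodgeModel_holds
    (by omega) hE2 hD hχ ψE
  obtain ⟨q, hq⟩ := RankTwoCM.exists_eq_ratCast_smul_of_commute_of_skew _ Nat.cast_one
    (BettiUniverse.hodge_isEffective exists_isReal_hodgeModel_holds hE 1) hV₂ ψE hχE (Nat.cast_pos.2 hD) hχ2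
    (commute_of_mem_hodgeLie _ hY ⟨_, hχE⟩) (form_apply_add_eq_zero_of_mem_hodgeLie ψE hY)
  have hq0 : q ≠ 0 := by rintro rfl; rw [zero_smul] at hq; exact hY0 hq
  have hmem : q⁻¹ • Y ∈ (BettiUniverse.hodge exists_isReal_hodgeModel_holds hE 1).hodgeLie := Submodule.smul_mem _ _ hY
  rwa [hq, smul_smul, inv_mul_cancel₀ hq0, one_smul] at hmem

/-- **`dim Lie Hg(H¹(B^{m+1})) = dim Lie Hg(H¹B)`** (`0 < dim B`; `t(B^{m+1}) = t(B)`, `CorCM/MumfordTateRankOfPowers`, and `t = dim Lie Hg + 1`).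
[cite: MoonenZarhin1999LowDim, §1] [cite: Moonen1999MTNotes, (1.8) and (1.13)] -/
theorem finrank_hodgeLie_hodge_one_powSucc_eq {m k : ℕ} (hP : IsSmoothProjective k (B.powSucc m).X) (hB : IsSmoothProjective n B.X) (hB0 : 0 < B.dim) :
    haveI := BettiUniverse.finite hP 1
    haveI := BettiUniverse.finite hB 1
    Module.finrank ℚ (BettiUniverse.hodge exists_isReal_hodgeModel_holds hP 1).hodgeLie =
      Module.finrank ℚ (BettiUniverse.hodge exists_isReal_hodgeModel_holds hB 1).hodgeLie := by
  have h := mtRank_hodge_one_eq_of_isIsogenous_powSucc hP hB hB0 (IsIsogenous.refl (B.powSucc m))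
  have hP0 : 0 < (B.powSucc m).dim := by
    rw [dim_eq_of_isIsogeny (isIsogenous_powSucc_biproduct B m).choose_spec, AndreRiemann.dim_biproduct_const]
    exact Nat.mul_pos (Nat.succ_pos m) hB0
  rw [mtRank_hodge_one_eq_finrank_hodgeLie_add_one hP hP0, mtRank_hodge_one_eq_finrank_hodgeLie_add_one hB hB0] at h
  omega

end CMCurve

end Summit.HodgeConjecture.CorCM

end
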